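import Summits.BirchSwinnertonDyer.BirchSwinnertonDyer.Theorems.SignedLowerHalvesKobayashiLowerHalfLargeImageKuriharaRigidityThm74Converse
import Summits.BirchSwinnertonDyer.BirchSwinnertonDyer.Theorems.SignedLowerHalvesKobayashiLowerHalfLargeImageKuriharaRigidityBindersOfFacts
import Summits.BirchSwinnertonDyer.BirchSwinnertonDyer.Theorems.SignedLowerHalvesKobayashiLowerHalfLargeImageKuriharaRigidityEquivalence
import Literature.NumberTheory.EllipticCurves.CastellaSano2026.KimTamagawaDefectOfKatoMainIdentityOPEN
import HarnessLib

/-!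
# Line `kurihara_rigidity` of crux `KobayashiLowerHalfLargeImage` (item stmt-BirchSwinnertonDyer-19001, route
# `SignedLowerHalves`): the lead's CONVERSE binder and the lead's EQUIVALENCE «crux 3 on X7 ∧ ¬CM ∧ Surj ∧ p ≥ 5
# ⟺ Kim's Conjecture 1.10 there» FROM NAMED FACTS BY NAME — both Castella–Sano directions on the `η = 1`
# package, Kobayashi Thm. 7.4 IN THE KERNEL both ways (cell `bsd-ssimc`, seat `bsd-line-slh-p1-w2` g2;
# `--supports … --as helper`)

The sibling `…KuriharaRigidityThm74Converse` (p610687) derives the lead's composite converse binder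
`Kobayashi74_CastellaSano2026_kimTamagawaDefect_of_signedMC_OPEN` (p609053: «a signed main conjecture for ONE sign
⟹ Kim's Conjecture 1.10», Kobayashi Thm. 7.4 ∘ Castella–Sano Thm. 1 (ii) ⟹ (i)) from a DISPLAYED frame — the
body of the Literature statement `CastellaSano2026.thm1_kimTamagawaDefect_of_katoMainIdentity_OPEN`, then in
flight — with Kobayashi's Thm. 7.4 run in the kernel in the converse direction
(`katoMainIdentity_of_kobayashiMainConjecture`). That statement has LANDED; this file restates the derivation
with the fact BY NAME (§1, definitional unfolding only), and feeds it — together with this seat's g0 derivation of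
the FORWARD composite binder (`castellaSano2026_thm1_via_kobayashi74_OPEN_of_facts`, p608428) — into the lead's
equivalence theorem `kobayashiLowerHalfLargeImage_iff_kimTamagawaDefect_X7` (p609449), so that the equivalence is
stated on the FINER inputs (§2): no composite binder, no theorem of Kobayashi's on faith.

TRUST BASE of the equivalence after this file (numbers, not adjectives): {Castella–Sano Thm. 1 (i) ⟹ (ii) and
(ii) ⟹ (i) read on the `η = 1` package [2 PREPRINT claims, never theorems], the package construction fact
`thm62_63_73_signedColemanKato_zeta`, Pollack's theorem, modularity `exists_isNewformOf`, Kobayashi Thm. 1.2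
(`thm12`, itself derived elsewhere from the package + Kato §12), Kobayashi Thm. 4.1 (`thm41`), the period facts
at `p ≥ 5` and `p = 3` [PUBLISHED]} — 0 composite binders; Kobayashi Thm. 7.4 in the kernel in both directions
(`…Thm74`, `…Thm74Converse`). HONEST FRAMING (cell `bsd-ssimc`, D-0036/D-0074): TOOL THEOREMS ONLY, no
definition, no named fact minted, no `sorry`, axioms standard; CONDITIONAL on the named facts displayed as
hypotheses; the class-wide crux, the line's hard stub (Kim's Conjecture 1.10 on X7 — promoted by the lead) and
the route are NOT closed; nothing is booked; BSD is not proved by any of this.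
`--supports stmt-BirchSwinnertonDyer-19001 --as helper`.

References: [CastellaSano2026] Thm. 1, Prop. 2.2.3, §2.4; [Kobayashi2003] Thm. 1.2, Thm. 4.1 (p. 8), Thm. 6.2–6.3
(p. 11), Thm. 7.3–7.4 (p. 13); [Pollack2003] Thm. 5.6, Cor. 5.11, Prop. 6.18; [Kim2022StructureSelmer] Conj. 1.10,
Thm. 1.11; [GreenbergVatsal2000] §3 Rem. 3.4; [AtkinLehner1970] Thm. 4.
-/

set_option autoImplicit false
-- single-problem summit (D-0017): the doubled namespace component is by design
set_option linter.dupNamespace false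

noncomputable section

open scoped Classical MatrixGroups ModularForm

open CongruenceSubgroup Field WeierstrassCurve Literature.NumberTheory.EllipticCurves
  Literature.NumberTheory.EllipticCurves.ModularForms Literature.NumberTheory.GaloisRepresentations
  Literature.NumberTheory.EllipticCurves.Rank1Residual Summit.BirchSwinnertonDyer.Rank1Residual.Supersingular
  Summit.BirchSwinnertonDyer.Rank1Residual.X4

namespace Summit.BirchSwinnertonDyer.BirchSwinnertonDyer.Theorems.KuriharaRigidity

/-! ## §1 The lead's converse binder from named facts BY NAME -/

/-- **`Kobayashi74_CastellaSano2026_kimTamagawaDefect_of_signedMC_OPEN` from NAMED inputs**: Castella–Sano Thm. 1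
(ii) ⟹ (i) read on the sign-`ε` `η = 1` package (`hCSc : CastellaSano2026.thm1_kimTamagawaDefect_of_katoMainIdentity_OPEN`,
[claim under-review] — never a theorem), the package construction fact (`hPkg`), Pollack's theorem (`hPollack`)
and modularity (`hmod`) — by `kobayashi74_castellaSano2026_kimTamagawaDefect_of_signedMC_OPEN_of_katoFrame`
(Kobayashi Thm. 7.4, converse direction, in the kernel). CONDITIONAL; closes nothing.
[claim: CastellaSano2026, status: under-review]
[cite: Kobayashi2003, Thm. 7.4 (p. 13), Thm. 6.2–6.3 (p. 11), Thm. 7.3 i) (p. 13)]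
[cite: Pollack2003, Thm. 5.6, Cor. 5.11 and Prop. 6.18] [cite: AtkinLehner1970, Thm. 4] -/
theorem kobayashi74_castellaSano2026_kimTamagawaDefect_of_signedMC_OPEN_of_facts
    (hCSc : CastellaSano2026.thm1_kimTamagawaDefect_of_katoMainIdentity_OPEN)
    (hPkg : Kobayashi2003.thm62_63_73_signedColemanKato_zeta)
    (hPollack : ∀ (W : WeierstrassCurve ℚ) [W.IsElliptic] [W.IsGloballyMinimal] {N : ℕ} [NeZero N]
        (f : CuspForm (Gamma0 N) 2) (p : ℕ) [Fact p.Prime],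
        pollack_exists_plusMinusPAdicLFunction (W := W) (f := f) (p := p))
    (hmod : exists_isNewformOf) :
    Kobayashi74_CastellaSano2026_kimTamagawaDefect_of_signedMC_OPEN :=
  kobayashi74_castellaSano2026_kimTamagawaDefect_of_signedMC_OPEN_of_katoFrame hCSc hPkg hPollack hmod

/-! ## §2 The lead's EQUIVALENCE on the finer inputs (no composite binder) -/

/-- **THE EQUIVALENCE of line `kurihara_rigidity`, on NAMED finer inputs**: the crux `KobayashiLowerHalfLargeImage`
BY NAME ⟺ (Kim's Tamagawa-defect identity `X4.KimTamagawaDefectAt W p f` for the newform of every X7 ∧ ¬CM ∧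
`a_p = 0` ∧ Surj pair at `p ≥ 5`) ∧ (the crux's own conclusion at `p = 3`) — the lead's
`kobayashiLowerHalfLargeImage_iff_kimTamagawaDefect_X7` (p609449) with BOTH composite binders discharged:
forward `CastellaSano2026_thm1_via_kobayashi74_OPEN` by `castellaSano2026_thm1_via_kobayashi74_OPEN_of_facts`
(this seat g0; Kobayashi 7.4 (ii) in the kernel), converse `Kobayashi74_CastellaSano2026_kimTamagawaDefect_of_signedMC_OPEN`
by §1 (Kobayashi 7.4 converse in the kernel). GRANTED, by name: Castella–Sano Thm. 1 in both directions on the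
`η = 1` package (`hCS`, `hCSc`; PREPRINT claims, never theorems), the package fact (`hPkg`), Pollack (`hPollack`),
modularity (`hmod`), Kobayashi Thm. 1.2 (`h12`) and Thm. 4.1 (`h41`), the period facts (`h5`, `h3`). CONDITIONAL;
closes nothing; BSD is not proved by any of this. [claim: CastellaSano2026, status: under-review]
[cite: Kobayashi2003, Thm. 1.2 (p. 2), Thm. 4.1 (p. 8), Thm. 7.4 (p. 13)] [cite: Kim2022StructureSelmer, Conj. 1.10 (PDF p. 8)]
[cite: GreenbergVatsal2000, §3, Remark 3.4] [cite: Pollack2003, Cor. 5.11 and Prop. 6.18] -/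
theorem kobayashiLowerHalfLargeImage_iff_kimTamagawaDefect_X7_of_facts
    (hCS : CastellaSano2026.thm1_katoMainIdentity_of_kimTamagawaDefect_OPEN)
    (hCSc : CastellaSano2026.thm1_kimTamagawaDefect_of_katoMainIdentity_OPEN)
    (hPkg : Kobayashi2003.thm62_63_73_signedColemanKato_zeta)
    (hPollack : ∀ (W : WeierstrassCurve ℚ) [W.IsElliptic] [W.IsGloballyMinimal] {N : ℕ} [NeZero N]
        (f : CuspForm (Gamma0 N) 2) (p : ℕ) [Fact p.Prime],
        pollack_exists_plusMinusPAdicLFunction (W := W) (f := f) (p := p))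
    (hmod : exists_isNewformOf)
    (h12 : Kobayashi2003.thm12_signedSelmerDual_finite_torsion)
    (h41 : Kobayashi2003.thm41_signedCharIdeal_divisibility)
    (h5 : realPeriodRat_eq_unit_mul_plusPeriod) (h3 : realPeriodRat_eq_unit_mul_plusPeriod_three) :
    Summit.BirchSwinnertonDyer.BirchSwinnertonDyer.Theses.SignedLowerHalves.KobayashiLowerHalfLargeImage ↔
      ((∀ (W : WeierstrassCurve ℚ) [W.IsElliptic] [W.IsGloballyMinimal] (p : ℕ) [Fact p.Prime],
          5 ≤ p → ClassX7 W p → ¬ W.HasCM → W.frobeniusTrace p = 0 → Surj W p →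
          ∀ [NeZero (W.conductorNorm ℤ)] (f : CuspForm (Gamma0 (W.conductorNorm ℤ)) 2),
            IsNewformOf W f → KimTamagawaDefectAt W p f) ∧
        (∀ (W : WeierstrassCurve ℚ) [W.IsElliptic] [W.IsGloballyMinimal] (p : ℕ) [Fact p.Prime],
          p = 3 → ClassX7 W p → ¬ W.HasCM → W.frobeniusTrace p = 0 → Surj W p →
          ∃ ε : ℤˣ, KobayashiLowerDivisibility W p ε)) :=
  kobayashiLowerHalfLargeImage_iff_kimTamagawaDefect_X7 (castellaSano2026_thm1_via_kobayashi74_OPEN_of_facts hCS h12 h5)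
    (kobayashi74_castellaSano2026_kimTamagawaDefect_of_signedMC_OPEN_of_facts hCSc hPkg hPollack hmod) h12 h41 h5 h3

end Summit.BirchSwinnertonDyer.BirchSwinnertonDyer.Theorems.KuriharaRigidity

end
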